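import Mathlib
import Summits.Ventures.PercRepro2.Defs
import Summits.Ventures.PercRepro2.Independence
import Summits.Ventures.PercRepro2.Harris
import Summits.Ventures.PercRepro2.CoinDefs
import Summits.Ventures.PercRepro2.CoinArcsOff
import Summits.Ventures.PercRepro2.CoinPendantDefs
import Summits.Ventures.PercRepro2.CoinPendant
import Summits.Ventures.PercRepro2.CoinInduced
import Summits.Ventures.PercRepro2.CoinVdBK
import Summits.Ventures.PercRepro2.CoinBHK
import Summits.Ventures.PercRepro2.CoinReverse
import Summits.Ventures.PercRepro2.CoinLemmaA
import Summits.Ventures.PercRepro2.CoinDarcMixed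
import Summits.Ventures.PercRepro2.CoinTwoPendantDefs
import Summits.Ventures.PercRepro2.CoinTwoPendantMass
import Summits.Ventures.PercRepro2.CoinTraceLevels

/-!
# Row 2′DARC at a GENERAL pendant head reduces to the sign of the trace functional (blind cell
PercRepro2, night-2 g3; proofs/NIGHT2-DARC.md §17)

`darc_of_trace_functional`: for a closed-out pendant set `P ∋ w` (single target `t`, mixed
pendant coins, `a, b, u ∉ P ∪ {t}`, the reduced avoidance events non-degenerate), the gate
functional of `u → w` satisfies
`Λ²·Φ(E) = Λ²·Σ_Z ℓ_Z·(inner covariance on the gate piece of Z) + S′`,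
`S′ = Σ_{Z ⊆ P} ℓ_Z Q̂_Z (x̂_Z Λ − MX)(ŷ_Z Λ − MY)`
(`Q̂_Z = P(R^{D₀}_{gateTarget Z})`, `x̂_Z` the conditional mean of the marker on that piece,
`Λ = P(R_T) = Σ ℓ_Z P_Z`, `MX = E[X; R_T]`), and the inner covariances are `≥ 0` by directed BHK on
`D₀` (`covC_nonneg`); hence `S′ ≥ 0 ⟹ DARC`.  This is NIGHT2-DARC.md (15.1) in the kernel for
every pendant set; the ABSTRACT PENDANT LEMMA (`S′ ≥ 0`) is what remains per head.
-/

namespace Summit.Ventures.PercRepro2.Coin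

section Reduce

open Classical

variable {V : Type*} {E : Type*} [Fintype V] [DecidableEq V] [Fintype E] [DecidableEq E]
  {R : Type*} [Field R] [LinearOrder R] [IsStrictOrderedRing R]

/-- **Row 2′DARC at a general pendant head, modulo the sign of the trace functional.** -/
theorem darc_of_trace_functional (p : E → R) (hp : IsProbVec p) {arcs : E → Finset (V × V)}
    (hS : SameEnds arcs) {P : Finset V} {t : V} (hclosed : ClosedOut arcs P {t})
    (hT : TailCoinsIn arcs P {t}) (s a b u w : V) (hw : w ∈ P) (ha : a ∉ P ∪ {t})
    (hb : b ∉ P ∪ {t}) (hu : u ∉ P ∪ {t})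
    (hQ : ∀ Z ∈ P.powerset,
      0 < prob p (avoidEvent (arcsOff arcs (P ∪ {t})) s (gateTarget u w Z {t})))
    (hS' : 0 ≤ ∑ Z ∈ P.powerset,
      prob p (traceLevel arcs {t} P Z) *
        prob p (avoidEvent (arcsOff arcs (P ∪ {t})) s (gateTarget u w Z {t})) *
        (massE p (marker (R := R) (arcsOff arcs (P ∪ {t})) s a)
            (avoidEvent (arcsOff arcs (P ∪ {t})) s (gateTarget u w Z {t})) /
          prob p (avoidEvent (arcsOff arcs (P ∪ {t})) s (gateTarget u w Z {t})) *
          (∑ Z' ∈ P.powerset, prob p (traceLevel arcs {t} P Z') *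
            prob p (avoidEvent (arcsOff arcs (P ∪ {t})) s (Z' ∪ {t})))
          - ∑ Z' ∈ P.powerset, prob p (traceLevel arcs {t} P Z') *
            massE p (marker (R := R) (arcsOff arcs (P ∪ {t})) s a)
              (avoidEvent (arcsOff arcs (P ∪ {t})) s (Z' ∪ {t}))) *
        (massE p (marker (R := R) (arcsOff arcs (P ∪ {t})) s b)
            (avoidEvent (arcsOff arcs (P ∪ {t})) s (gateTarget u w Z {t})) /
          prob p (avoidEvent (arcsOff arcs (P ∪ {t})) s (gateTarget u w Z {t})) *
          (∑ Z' ∈ P.powerset, prob p (traceLevel arcs {t} P Z') *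
            prob p (avoidEvent (arcsOff arcs (P ∪ {t})) s (Z' ∪ {t})))
          - ∑ Z' ∈ P.powerset, prob p (traceLevel arcs {t} P Z') *
            massE p (marker (R := R) (arcsOff arcs (P ∪ {t})) s b)
              (avoidEvent (arcsOff arcs (P ∪ {t})) s (Z' ∪ {t})))) :
    DARC p arcs s {t} a b u w := by
  have hS₀ : SameEnds (arcsOff arcs (P ∪ {t})) := sameEnds_arcsOff hS _
  set D₀ := arcsOff arcs (P ∪ {t}) with hD₀
  set X₀ : Config E → R := marker D₀ s a with hX₀
  set Y₀ : Config E → R := marker D₀ s b with hY₀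
  -- the markers on `R_T` are the reduced markers
  have hdepX : DependsOn X₀ (tailCoins arcs P)ᶜ := trace_dependsOn_marker hT s a
  have hdepY : DependsOn Y₀ (tailCoins arcs P)ᶜ := trace_dependsOn_marker hT s b
  have hdepXY : DependsOn (fun ω => X₀ ω * Y₀ ω) (tailCoins arcs P)ᶜ := fun ω ω' h => by
    show X₀ ω * Y₀ ω = X₀ ω' * Y₀ ω'
    rw [hdepX h, hdepY h]
  have hdep1 : DependsOn (fun _ : Config E => (1 : R)) (tailCoins arcs P)ᶜ := fun _ _ _ => rfl
  have hmX : ∀ ω ∈ avoidEvent arcs s {t}, marker (R := R) arcs s a ω = X₀ ω := by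
    intro ω hω
    have hr := reach_iff_trace hclosed hω ha
    simp only [hX₀, marker, hr, hD₀]
  have hmY : ∀ ω ∈ avoidEvent arcs s {t}, marker (R := R) arcs s b ω = Y₀ ω := by
    intro ω hω
    have hr := reach_iff_trace hclosed hω hb
    simp only [hY₀, marker, hr, hD₀]
  have hmXY : ∀ ω ∈ avoidEvent arcs s {t},
      marker (R := R) arcs s a ω * marker (R := R) arcs s b ω = X₀ ω * Y₀ ω :=
    fun ω hω => by rw [hmX ω hω, hmY ω hω]
  have eX := trace_mass p hclosed hT s hu hw hdepX hmX
  have eY := trace_mass p hclosed hT s hu hw hdepY hmY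
  have eXY := trace_mass p hclosed hT s hu hw hdepXY hmXY
  have e1 := trace_mass p hclosed hT s hu hw hdep1 (fun _ _ => rfl)
  simp only [← prob_eq_massE_one] at e1
  unfold DARC phiC
  simp only []
  rw [e1.1, eX.1, eY.1, e1.2, eX.2, eY.2, eXY.2]
  -- the per-trace identity: `Λ²·ℓ Ĉ − Λ MX ℓ B̂ − Λ MY ℓ Â + MX MY ℓ Q̂ = Λ² ℓ (Ĉ − ÂB̂/Q̂) + ℓ Q̂ (x̂Λ − MX)(ŷΛ − MY)`
  obtain ⟨Λ, hΛ⟩ : ∃ L : R, L = ∑ Z ∈ P.powerset, prob p (traceLevel arcs {t} P Z) *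
      prob p (avoidEvent D₀ s (Z ∪ {t})) := ⟨_, rfl⟩
  obtain ⟨MX, hMX⟩ : ∃ M : R, M = ∑ Z ∈ P.powerset, prob p (traceLevel arcs {t} P Z) *
      massE p X₀ (avoidEvent D₀ s (Z ∪ {t})) := ⟨_, rfl⟩
  obtain ⟨MY, hMY⟩ : ∃ M : R, M = ∑ Z ∈ P.powerset, prob p (traceLevel arcs {t} P Z) *
      massE p Y₀ (avoidEvent D₀ s (Z ∪ {t})) := ⟨_, rfl⟩
  rw [← hΛ, ← hMX, ← hMY] at hS' ⊢
  have hcov : 0 ≤ ∑ Z ∈ P.powerset, Λ ^ 2 * (prob p (traceLevel arcs {t} P Z) *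
      (massE p (fun ω => X₀ ω * Y₀ ω) (avoidEvent D₀ s (gateTarget u w Z {t}))
        - massE p X₀ (avoidEvent D₀ s (gateTarget u w Z {t})) *
          massE p Y₀ (avoidEvent D₀ s (gateTarget u w Z {t})) /
          prob p (avoidEvent D₀ s (gateTarget u w Z {t})))) := by
    refine Finset.sum_nonneg fun Z hZ => ?_
    have hq := hQ Z hZ
    have hc := covC_nonneg p hp hS₀ s a b (gateTarget u w Z {t})
    simp only [covC] at hc
    refine mul_nonneg (sq_nonneg _) (mul_nonneg (prob_nonneg hp _) ?_)
    rw [sub_nonneg, div_le_iff₀ hq]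
    linarith
  have key : Λ ^ 2 * ∑ Z ∈ P.powerset, prob p (traceLevel arcs {t} P Z) *
        massE p (fun ω => X₀ ω * Y₀ ω) (avoidEvent D₀ s (gateTarget u w Z {t}))
      - Λ * MX * ∑ Z ∈ P.powerset, prob p (traceLevel arcs {t} P Z) *
        massE p Y₀ (avoidEvent D₀ s (gateTarget u w Z {t}))
      - Λ * MY * ∑ Z ∈ P.powerset, prob p (traceLevel arcs {t} P Z) *
        massE p X₀ (avoidEvent D₀ s (gateTarget u w Z {t}))
      + MX * MY * ∑ Z ∈ P.powerset, prob p (traceLevel arcs {t} P Z) *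
        prob p (avoidEvent D₀ s (gateTarget u w Z {t}))
      = (∑ Z ∈ P.powerset, Λ ^ 2 * (prob p (traceLevel arcs {t} P Z) *
          (massE p (fun ω => X₀ ω * Y₀ ω) (avoidEvent D₀ s (gateTarget u w Z {t}))
            - massE p X₀ (avoidEvent D₀ s (gateTarget u w Z {t})) *
              massE p Y₀ (avoidEvent D₀ s (gateTarget u w Z {t})) /
              prob p (avoidEvent D₀ s (gateTarget u w Z {t})))))
        + ∑ Z ∈ P.powerset, prob p (traceLevel arcs {t} P Z) *
          prob p (avoidEvent D₀ s (gateTarget u w Z {t})) *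
          (massE p X₀ (avoidEvent D₀ s (gateTarget u w Z {t})) /
            prob p (avoidEvent D₀ s (gateTarget u w Z {t})) * Λ - MX) *
          (massE p Y₀ (avoidEvent D₀ s (gateTarget u w Z {t})) /
            prob p (avoidEvent D₀ s (gateTarget u w Z {t})) * Λ - MY) := by
    rw [Finset.mul_sum, Finset.mul_sum, Finset.mul_sum, Finset.mul_sum, ← Finset.sum_sub_distrib,
      ← Finset.sum_sub_distrib, ← Finset.sum_add_distrib, ← Finset.sum_add_distrib]
    refine Finset.sum_congr rfl fun Z hZ => ?_
    have hq := (hQ Z hZ).ne'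
    field_simp
    ring
  rw [key]
  exact add_nonneg hcov hS'

end Reduce

end Summit.Ventures.PercRepro2.Coin
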